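import Literature.AnabelianGeometry.AbsoluteAnabelian.UnitKummerNaturality
import Literature.AnabelianGeometry.EtaleTheta.KummerFunctorialityCovariant
import HarnessLib

/-!
# [AbsTopIII] Prop 3.3 (i): naturality of the MODEL unit Kummer maps along general morphisms, in the
# covariant `EquivariantMorphism` currency (`pullH1` / `pushH1`, coefficients `Rep.res`)

S. Mochizuki, *Topics in absolute anabelian geometry III*, §3, Prop. 3.3 (i) p. 73 (bib key
`MochizukiAbsTopIII2015`): the Kummer maps `M^H → H¹(H, μ_Ẑ(M))` are "functorial [i.e., relative to
`C^MLF_T`, in the evident sense]" — along the GENERAL morphisms `(φ_Π, φ_M)` of Def. 3.1 (ii) p. 67.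

abc-iut cell, layer L4, row «Prop33i-NATURALITY», ADDENDUM (seat abc-iut-w4-d009 gen 4).  PROOF-ONLY, 0 `def`s.
`UnitKummerNaturality.lean` (p429455) states the naturality square of the MODEL unit Kummer theories
(`ModelMLFGaloisData.unitKummerTheoryTLG/TCG`, abc-iut-L4-t2) through the LANA-§6.1 CO-morphism API of
`EtaleTheta/KummerFunctoriality.lean`, which needs the restricted action of `Π₁` on `k̄₂ˣ` as an auxiliary
compatible action.  abc-iut-L4-t2's `EtaleTheta/KummerFunctorialityCovariant.lean` (p428982) types the covariant
shape of a Def. 3.1 (ii) morphism directly — `EquivariantMorphism (φ, ψ)`, pull-back `pullH1` and push-forward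
`pushH1` into `H¹(H₁, res_φ Λ(A₂))` (Mathlib `Rep.res`, NO auxiliary action) with `pullH1_kummerClass` — and is
the currency of the sibling node AbsTopIII:Prop3.2(ii) (`TM`).  This file restates the `TLG`/`TCG` model
naturality in THAT currency, consuming everything BY NAME:

* `GaloisMonoidPair.Hom.tlgUnitsMorphism_pullH1_kummer` — for ANY morphism `φ : D₁.tlgPair ⟶ D₂.tlgPair` of the
  model `TLG`-pairs (two MLF closures), the equivariant morphism `(φ_Π, φ_M|_{k̄ˣ})` satisfies
  `pullH1 (κ₂ m₂) = pushH1 (κ₁ m₁)` whenever `φ_M m₁ = m₂` (`H₁`, `H₂` open, `φ_Π(H₁) ≤ H₂`); NO auxiliary datum;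
* `…_comap` — the canonical level `H₁ := φ_Π⁻¹(H₂)`;
* `GaloisMonoidPair.Hom.tcgUnitsMorphism_pullH1_kummer` — the `TCG` square for a morphism of the model
  `TCG`-pairs together with a `φ_Π`-equivariant extension `Φ` of `φ_M` to `k̄ˣ` (t2's model `TCG` classes live
  in `H¹(H, Λ(k̄ˣ))`; `Λ(φ_M)` only sees torsion ⊆ `𝒪^×`, so `Φ` is bookkeeping — see p429455's header).

HONEST FRAMING: OUR kernel statements about the model objects of a refereed 2015 paper; functoriality AT THE
MODEL (genuine Kummer classes); the abstract-pair clause (independence of the transported theory from the chosen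
model presentation) is a separate row.  Nothing here bears on [IUTchIII] Cor. 3.12.
-/

noncomputable section

open scoped nonZeroDivisors

namespace Literature.AnabelianGeometry.AbsoluteAnabelian

open Literature.AnabelianGeometry.EtaleTheta (EquivariantMorphism kummerClass invariants)

namespace GaloisMonoidPair.Hom

variable {C₁ C₂ : MLFClosure.{0}} {D₁ : ModelMLFGaloisData C₁.k C₁.K} {D₂ : ModelMLFGaloisData C₂.k C₂.K}

/-! ### `TLG`: `(Π_k ↷ k̄^×)` -/

/-- **Prop 3.3 (i) functoriality, model `TLG`-pairs, covariant currency.**  For a morphism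
`φ = (φ_Π, φ_M) : (Π_{k₁} ↷ k̄₁^×) → (Π_{k₂} ↷ k̄₂^×)` of the model `TLG`-pairs (Def. 3.1 (ii); `φ_Π` any compatible
continuous homomorphism, NOT assumed invertible), the equivariant morphism `(φ_Π, φ_M read on k̄ˣ)` (equivariance
= `ModelMLFGaloisData.tlgHom_unitsMap_smul`), open `H₁ ≤ Π_{k₁}`, `H₂ ≤ Π_{k₂}` with `φ_Π(H₁) ≤ H₂`, and
`m₁ ∈ (k̄₁^×)^{H₁}`, `m₂ ∈ (k̄₂^×)^{H₂}` with `φ_M(m₁) = m₂`: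
`φ_Π^* (κ_{H₂} m₂) = Λ(φ_M)_* (κ_{H₁} m₁)` in `H¹(H₁, res_{φ_Π} Λ(k̄₂ˣ))`, the `κ` being the Kummer maps of t2's
`unitKummerTheoryTLG` (abc-iut-L4-t2's `EquivariantMorphism.pullH1_kummerClass` BY NAME).
[cite: MochizukiAbsTopIII2015, Proposition 3.3 (i) p.73] -/
theorem tlgUnitsMorphism_pullH1_kummer (φ : GaloisMonoidPair.Hom D₁.tlgPair D₂.tlgPair)
    {H₁ : OpenSubgroup D₁.tlgPair.Pi} {H₂ : OpenSubgroup D₂.tlgPair.Pi}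
    (hH : (H₁ : Subgroup D₁.Pi).map φ.homPi ≤ (H₂ : Subgroup D₂.Pi))
    (m₁ : {m : D₁.tlgPair.M // ∀ h : H₁, (h : D₁.tlgPair.Pi) • m = m})
    (m₂ : {m : D₂.tlgPair.M // ∀ h : H₂, (h : D₂.tlgPair.Pi) • m = m}) (h : φ.homM m₁.1 = m₂.1) :
    (⟨φ.homPi, nonZeroDivisorsEquivUnits.toMonoidHom.comp
          (φ.homM.comp (nonZeroDivisorsEquivUnits (G₀ := C₁.K)).symm.toMonoidHom),
        ModelMLFGaloisData.tlgHom_unitsMap_smul C₁ C₂ D₁ D₂ φ⟩ :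
        EquivariantMorphism D₁.Pi (C₁.K)ˣ D₂.Pi (C₂.K)ˣ).pullH1 hH
        ((D₂.unitKummerTheoryTLG C₂).kummer H₂ m₂) =
      (⟨φ.homPi, nonZeroDivisorsEquivUnits.toMonoidHom.comp
          (φ.homM.comp (nonZeroDivisorsEquivUnits (G₀ := C₁.K)).symm.toMonoidHom),
        ModelMLFGaloisData.tlgHom_unitsMap_smul C₁ C₂ D₁ D₂ φ⟩ :
        EquivariantMorphism D₁.Pi (C₁.K)ˣ D₂.Pi (C₂.K)ˣ).pushH1 hH
        ((D₁.unitKummerTheoryTLG C₁).kummer H₁ m₁) := by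
  rw [ModelMLFGaloisData.unitKummerTheoryTLG_kummer, ModelMLFGaloisData.unitKummerTheoryTLG_kummer]
  refine EquivariantMorphism.pullH1_kummerClass _ hH _ _ ?_
  change nonZeroDivisorsEquivUnits (φ.homM ((nonZeroDivisorsEquivUnits (G₀ := C₁.K)).symm
      (ModelMLFGaloisData.tlgToUnit C₁ m₁.1))) = ModelMLFGaloisData.tlgToUnit C₂ m₂.1
  rw [ModelMLFGaloisData.tlgToUnit_eq_nonZeroDivisorsEquivUnits,
    ModelMLFGaloisData.tlgToUnit_eq_nonZeroDivisorsEquivUnits, MulEquiv.symm_apply_apply, h]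

/-- The canonical level `H₁ := φ_Π⁻¹(H₂)` of `tlgUnitsMorphism_pullH1_kummer`: for open `H₂ ≤ Π_{k₂}`,
`m₁ ∈ (k̄₁^×)^{φ_Π⁻¹ H₂}` and `m₂ ∈ (k̄₂^×)^{H₂}` with `φ_M(m₁) = m₂`, the square commutes at
`(φ_Π⁻¹ H₂, H₂)`. [cite: MochizukiAbsTopIII2015, Proposition 3.3 (i) p.73] -/
theorem tlgUnitsMorphism_pullH1_kummer_comap (φ : GaloisMonoidPair.Hom D₁.tlgPair D₂.tlgPair)
    (H₂ : OpenSubgroup D₂.tlgPair.Pi)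
    (m₁ : {m : D₁.tlgPair.M //
      ∀ h : (H₂.comap φ.homPi φ.continuous_homPi : OpenSubgroup D₁.tlgPair.Pi), (h : D₁.tlgPair.Pi) • m = m})
    (m₂ : {m : D₂.tlgPair.M // ∀ h : H₂, (h : D₂.tlgPair.Pi) • m = m}) (h : φ.homM m₁.1 = m₂.1) :
    (⟨φ.homPi, nonZeroDivisorsEquivUnits.toMonoidHom.comp
          (φ.homM.comp (nonZeroDivisorsEquivUnits (G₀ := C₁.K)).symm.toMonoidHom),
        ModelMLFGaloisData.tlgHom_unitsMap_smul C₁ C₂ D₁ D₂ φ⟩ :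
        EquivariantMorphism D₁.Pi (C₁.K)ˣ D₂.Pi (C₂.K)ˣ).pullH1 (ModelMLFGaloisData.map_comap_homPi_le φ H₂)
        ((D₂.unitKummerTheoryTLG C₂).kummer H₂ m₂) =
      (⟨φ.homPi, nonZeroDivisorsEquivUnits.toMonoidHom.comp
          (φ.homM.comp (nonZeroDivisorsEquivUnits (G₀ := C₁.K)).symm.toMonoidHom),
        ModelMLFGaloisData.tlgHom_unitsMap_smul C₁ C₂ D₁ D₂ φ⟩ :
        EquivariantMorphism D₁.Pi (C₁.K)ˣ D₂.Pi (C₂.K)ˣ).pushH1 (ModelMLFGaloisData.map_comap_homPi_le φ H₂)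
        ((D₁.unitKummerTheoryTLG C₁).kummer (H₂.comap φ.homPi φ.continuous_homPi) m₁) :=
  tlgUnitsMorphism_pullH1_kummer φ (ModelMLFGaloisData.map_comap_homPi_le φ H₂) m₁ m₂ h

/-! ### `TCG`: `(Π_k ↷ 𝒪_k̄^×)` -/

/-- **Prop 3.3 (i) functoriality, model `TCG`-pairs, covariant currency**, for a morphism
`φ = (φ_Π, φ_M) : (Π_{k₁} ↷ 𝒪_{k̄₁}^×) → (Π_{k₂} ↷ 𝒪_{k̄₂}^×)` of the model `TCG`-pairs given together with a
`φ_Π`-equivariant extension `Φ : k̄₁ˣ → k̄₂ˣ` of `φ_M` (bookkeeping datum, see the module docstring): for open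
`H₁`, `H₂` with `φ_Π(H₁) ≤ H₂` and `m₁ ∈ (𝒪_{k̄₁}^×)^{H₁}`, `m₂ ∈ (𝒪_{k̄₂}^×)^{H₂}` with `φ_M(m₁) = m₂`,
`φ_Π^* (κ_{H₂} m₂) = Λ(Φ)_* (κ_{H₁} m₁)` for the Kummer maps of t2's `unitKummerTheoryTCG`.
[cite: MochizukiAbsTopIII2015, Proposition 3.3 (i) p.73] -/
theorem tcgUnitsMorphism_pullH1_kummer (φ : GaloisMonoidPair.Hom D₁.tcgPair D₂.tcgPair)
    (Φ : (C₁.K)ˣ →* (C₂.K)ˣ)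
    (hΦ : ∀ m : unitSubmonoid C₁.k C₁.K,
      Φ (ModelMLFGaloisData.tcgToUnit C₁ m) = ModelMLFGaloisData.tcgToUnit C₂ (φ.homM m))
    (hΦs : ∀ (g : D₁.Pi) (u : (C₁.K)ˣ), Φ (g • u) = φ.homPi g • Φ u)
    {H₁ : OpenSubgroup D₁.tcgPair.Pi} {H₂ : OpenSubgroup D₂.tcgPair.Pi}
    (hH : (H₁ : Subgroup D₁.Pi).map φ.homPi ≤ (H₂ : Subgroup D₂.Pi))
    (m₁ : {m : D₁.tcgPair.M // ∀ h : H₁, (h : D₁.tcgPair.Pi) • m = m})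
    (m₂ : {m : D₂.tcgPair.M // ∀ h : H₂, (h : D₂.tcgPair.Pi) • m = m}) (h : φ.homM m₁.1 = m₂.1) :
    (⟨φ.homPi, Φ, hΦs⟩ : EquivariantMorphism D₁.Pi (C₁.K)ˣ D₂.Pi (C₂.K)ˣ).pullH1 hH
        ((D₂.unitKummerTheoryTCG C₂).kummer H₂ m₂) =
      (⟨φ.homPi, Φ, hΦs⟩ : EquivariantMorphism D₁.Pi (C₁.K)ˣ D₂.Pi (C₂.K)ˣ).pushH1 hH
        ((D₁.unitKummerTheoryTCG C₁).kummer H₁ m₁) := by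
  rw [ModelMLFGaloisData.unitKummerTheoryTCG_kummer, ModelMLFGaloisData.unitKummerTheoryTCG_kummer]
  refine EquivariantMorphism.pullH1_kummerClass _ hH _ _ ?_
  change Φ (ModelMLFGaloisData.tcgToUnit C₁ m₁.1) = ModelMLFGaloisData.tcgToUnit C₂ m₂.1
  rw [hΦ, h]

/-- The `TCG` square over ONE MLF closure for a morphism whose `φ_Π` lies over `G_k` (`ε' ∘ φ_Π = ε`) and
whose `φ_M` is the restriction of a Galois-equivariant `Φ : k̄ˣ → k̄ˣ` (e.g. `Φ = id`: inclusions of open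
subgroups). [cite: MochizukiAbsTopIII2015, Proposition 3.3 (i) p.73] -/
theorem tcgUnitsMorphism_pullH1_kummer_of_aug {C : MLFClosure.{0}} {D D' : ModelMLFGaloisData C.k C.K}
    (φ : GaloisMonoidPair.Hom D.tcgPair D'.tcgPair) (haug : ∀ g : D.Pi, D'.aug (φ.homPi g) = D.aug g)
    (Φ : (C.K)ˣ →* (C.K)ˣ)
    (hΦ : ∀ m : unitSubmonoid C.k C.K,
      Φ (ModelMLFGaloisData.tcgToUnit C m) = ModelMLFGaloisData.tcgToUnit C (φ.homM m))
    (hΦs : ∀ (g : D.Pi) (u : (C.K)ˣ), Φ (g • u) = g • Φ u)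
    {H₁ : OpenSubgroup D.tcgPair.Pi} {H₂ : OpenSubgroup D'.tcgPair.Pi}
    (hH : (H₁ : Subgroup D.Pi).map φ.homPi ≤ (H₂ : Subgroup D'.Pi))
    (m₁ : {m : D.tcgPair.M // ∀ h : H₁, (h : D.tcgPair.Pi) • m = m})
    (m₂ : {m : D'.tcgPair.M // ∀ h : H₂, (h : D'.tcgPair.Pi) • m = m}) (h : φ.homM m₁.1 = m₂.1) :
    (⟨φ.homPi, Φ, fun g u => (hΦs g u).trans (Units.ext (by
        rw [ModelMLFGaloisData.units_coe_smul, ModelMLFGaloisData.units_coe_smul, haug]))⟩ :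
        EquivariantMorphism D.Pi (C.K)ˣ D'.Pi (C.K)ˣ).pullH1 hH ((D'.unitKummerTheoryTCG C).kummer H₂ m₂) =
      (⟨φ.homPi, Φ, fun g u => (hΦs g u).trans (Units.ext (by
        rw [ModelMLFGaloisData.units_coe_smul, ModelMLFGaloisData.units_coe_smul, haug]))⟩ :
        EquivariantMorphism D.Pi (C.K)ˣ D'.Pi (C.K)ˣ).pushH1 hH ((D.unitKummerTheoryTCG C).kummer H₁ m₁) :=
  tcgUnitsMorphism_pullH1_kummer φ Φ hΦ _ hH m₁ m₂ h

end GaloisMonoidPair.Hom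

end Literature.AnabelianGeometry.AbsoluteAnabelian

end
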